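import Summits.Parity.GeneralizedHardyLittlewood.Theorems.Dhl42CertSetup

/-!
# DHL[42,2] certificate — Lemma 6.2 for general data, part 2: the proof (`CertSetup.certIneq`)

§5 (second half), step by printed step: `A_{jβ} = k·a_{jβ}` by integrating out the counted
coordinate (`A_eq`); the fibre length `∫1_{E_j}(s,t')1_β(s)ds = ℓ_{jβ}(t')`
(`integral_ind_cons_eq_lenE`) and `∫ bI = B_{jβ}/k` by Fubini (`b'_eq_b`); the pointwise
`2|ab| ≤ γa² + γ⁻¹b²` and the optimisation `γ = √(B/A)` (`amgm_pointwise`, `two_y_le`,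
`le_sqrt_of_amgm`, `y_le_sqrt`); the cover step `|E-integrand| ≤ Σ_j Σ_i` binned integrands
(`abs_errI_le`); whence `k∫_{Ω'}E₁(F₀)₁ ≤ Σ√(AB)` (`errInner_le_cross`) and **Lemma 6.2**
`CertSetup.certIneq : k·J^K − k·L_G − 2·cross ≤ varLHS F (fun _ ↦ G)`.

Origin: `Dhl42/CertificateInequality.lean` of the DHL[42,2] certificate package (pub-dhl42 bundle,
archive blob `18cce9e3`; sha256[:16] of the file `ba7c9b2361ca6afe`; paper snapshot =
`paper/main.tex` v1), lines :699–:972; statements and proofs unchanged except: namespace `TpY4Dhl42`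
→ `Summit.Parity.GeneralizedHardyLittlewood.Theorems.Dhl42`, the package's `simplexSet n B` replaced
by the tree's definitionally equal `Literature.NumberTheory.Sieve.scaledSimplex n B` (also inside
declaration names), docstrings added where missing, `#print axioms` lines dropped. Package-internal
references in the verbatim docstrings (`Dhl42/….lean`, `Assumed.…`, `row 9…`, `gen n`,
`inputs/COMPARE.md`) refer to that package (paper Appendix B).

Declarations (20): `A_eq`, `integral_ind_cons_eq_lenE`, `b'_eq_b`, `amgm_pointwise`,
`mul_eq_zero_or_one`, `two_y_le`, `le_sqrt_of_amgm`, `aI_nonneg`, `a_nonneg`, `lenE_nonneg`,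
`b_nonneg`, `yI_nonneg`, `y_le_sqrt`, `integrable_errI`, `errInner_eq`, `abs_errI_le`,
`errInner_le`, `sqrt_A_mul_B`, `errInner_le_cross`, `certIneq`.
-/

open MeasureTheory Set Filter
open Literature.NumberTheory.Sieve (scaledSimplex)

namespace Summit.Parity.GeneralizedHardyLittlewood.Theorems.Dhl42

noncomputable section

namespace CertSetup

variable {n : ℕ} {J : Type} [Fintype J] {I : J → Type} [∀ j, Fintype (I j)]
variable (D : CertSetup n J I)

/-- `A_{jβ} = k · a_{jβ}`: integrate out the counted coordinate `t_m` first and use the symmetry of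
`F₀` and `E_j` (each of the `k` coordinates contributes the same amount). -/
theorem A_eq (j : J) {β : Set ℝ} (hβ : MeasurableSet β) : D.A j β = ((n : ℝ) + 1) * D.a j β := by
  set φ : Fin (n + 1) → (Fin (n + 1) → ℝ) → ℝ :=
    fun m t => ind (D.E j) t * ind β (t m) * D.F0 t ^ 2 with hφ
  have hφt : ∀ m, Tame (scaledSimplex (n + 1) D.S) (φ m) := fun m =>
    (D.tame_F0.sq).bdd_mul ((measurable_ind (D.measurableSet_E j)).mul
      ((measurable_ind hβ).comp (measurable_pi_apply m)))
      (bdd_mul (bdd_ind _) (bdd_comp (bdd_ind β) _))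
  have h1 : D.A j β = ∫ t, ∑ m, φ m t := by
    unfold A
    rw [← integral_indicator (D.measurableSet_E j)]
    congr 1
    funext t
    simp only [hφ, indCount]
    by_cases ht : t ∈ D.E j
    · rw [indicator_of_mem ht, ind_of_mem ht, Finset.mul_sum]
      exact Finset.sum_congr rfl fun m _ => by ring
    · rw [indicator_of_notMem ht, ind_of_notMem ht]
      simp
  have h2 : ∫ t, ∑ m, φ m t = ∑ m, ∫ t, φ m t :=
    integral_finsetSum _ fun m _ => (hφt m).integrable (volume_simplex_ne_top _ _)
  have h3 : ∀ m, ∫ t, φ m t = D.a j β := by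
    intro m
    rw [integral_eq_integral_insertNth m]
    unfold a
    congr 1
    funext p
    simp only [hφ, aI, Fin.insertNth_apply_same, D.F0_insertNth]
    rw [ind_congr (D.insertNth_mem_E j m p.1 p.2)]
  rw [h1, h2, Finset.sum_congr rfl fun m _ => h3 m, Finset.sum_const, Finset.card_univ,
    Fintype.card_fin, nsmul_eq_mul, Nat.cast_add, Nat.cast_one]

/-- The fibre length: `∫ 1_{E_j}(s, t') 1_β(s) ds = ℓ_{jβ}(t')`. -/
theorem integral_ind_cons_eq_lenE (j : J) {β : Set ℝ} (hβ : MeasurableSet β) (t' : Fin n → ℝ) :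
    ∫ s, ind (D.E j) (Fin.cons s t' : Fin (n + 1) → ℝ) * ind β s = D.lenE j β t' := by
  have hset : {s : ℝ | (s ∈ β ∧ s ∈ Icc (0 : ℝ) (D.S - ∑ i, t' i)) ∧
      (Fin.cons s t' : Fin (n + 1) → ℝ) ∈ D.E j} =
      {s : ℝ | (Fin.cons s t' : Fin (n + 1) → ℝ) ∈ D.E j} ∩ β := by
    ext s
    simp only [mem_setOf_eq, mem_inter_iff]
    constructor
    · rintro ⟨⟨hb, -⟩, hE⟩
      exact ⟨hE, hb⟩
    · rintro ⟨hE, hb⟩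
      exact ⟨⟨hb, mem_Icc_of_cons_mem_scaledSimplex (D.E_subset j hE)⟩, hE⟩
  have hmeas : MeasurableSet ({s : ℝ | (Fin.cons s t' : Fin (n + 1) → ℝ) ∈ D.E j} ∩ β) :=
    ((continuous_cons_left t').measurable (D.measurableSet_E j)).inter hβ
  have e1 : ∀ s : ℝ, ind (D.E j) (Fin.cons s t' : Fin (n + 1) → ℝ) * ind β s =
      ind ({s : ℝ | (Fin.cons s t' : Fin (n + 1) → ℝ) ∈ D.E j} ∩ β) s := fun s => by
    rw [ind_congr (show (Fin.cons s t' : Fin (n + 1) → ℝ) ∈ D.E j ↔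
      s ∈ {s : ℝ | (Fin.cons s t' : Fin (n + 1) → ℝ) ∈ D.E j} from Iff.rfl), ind_mul_ind]
  unfold lenE
  rw [hset]
  simp_rw [e1]
  rw [integral_ind hmeas]
  rfl

/-- `∫ bI = b` (Fubini: integrate out `s` first; the inner integral is the fibre length). -/
theorem b'_eq_b (j : J) {β : Set ℝ} (hβ : MeasurableSet β) : D.b' j β = D.b j β := by
  unfold b'
  rw [integral_prod_eq_integral_integral _ ((D.tame_bI j hβ).integrable D.volume_box_ne_top)]
  have hin : ∀ t' : Fin n → ℝ,
      ∫ s, D.bI j β (s, t') = D.lenE j β t' * (marg D.F0 t' ^ 2 * ind D.Ω' t') := by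
    intro t'
    simp only [bI]
    rw [integral_mul_const, D.integral_ind_cons_eq_lenE j hβ t']
  simp_rw [hin]
  unfold b
  rw [← integral_indicator D.measurableSet_Ω']
  congr 1
  funext t'
  by_cases ht : t' ∈ D.Ω'
  · rw [indicator_of_mem ht, ind_of_mem ht]
    ring
  · rw [indicator_of_notMem ht, ind_of_notMem ht]
    ring

/-- The pointwise inequality `2|ab| ≤ γ a² + γ⁻¹ b²` on the set where the indicators are `1`. -/
theorem amgm_pointwise {u v x z γ : ℝ} (hu : u = 0 ∨ u = 1) (hv : v = 0 ∨ v = 1) (hγ : 0 < γ) :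
    2 * (u * (|z| * v) * |x|) ≤ γ * (u * x ^ 2) + γ⁻¹ * (u * (z ^ 2 * v)) := by
  rcases hu with rfl | rfl
  · simp
  rcases hv with rfl | rfl
  · simp only [mul_zero, zero_mul, one_mul, add_zero]
    positivity
  · simp only [mul_one, one_mul]
    have key : γ * (2 * (|z| * |x|)) ≤ γ * (γ * x ^ 2 + γ⁻¹ * z ^ 2) := by
      rw [mul_add, ← mul_assoc γ γ⁻¹, mul_inv_cancel₀ hγ.ne', one_mul, ← sq_abs x, ← sq_abs z]
      nlinarith [sq_nonneg (γ * |x| - |z|)]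
    exact le_of_mul_le_mul_left key hγ

/-- A product of two numbers in `{0, 1}` is in `{0, 1}`. -/
theorem mul_eq_zero_or_one {u v : ℝ} (hu : u = 0 ∨ u = 1) (hv : v = 0 ∨ v = 1) :
    u * v = 0 ∨ u * v = 1 := by
  rcases hu with rfl | rfl <;> rcases hv with rfl | rfl <;> simp

/-- `2 y ≤ γ a + γ⁻¹ ∫ bI` for every `γ > 0`. -/
theorem two_y_le (j : J) {β : Set ℝ} (hβ : MeasurableSet β) {γ : ℝ} (hγ : 0 < γ) :
    2 * D.y j β ≤ γ * D.a j β + γ⁻¹ * D.b' j β := by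
  have ha := (D.tame_aI j hβ).integrable D.volume_box_ne_top
  have hb := (D.tame_bI j hβ).integrable D.volume_box_ne_top
  have hy := (D.tame_yI j hβ).integrable D.volume_box_ne_top
  unfold y a b'
  rw [← integral_const_mul, ← integral_const_mul, ← integral_const_mul,
    ← integral_add (ha.const_mul γ) (hb.const_mul γ⁻¹)]
  refine integral_mono (hy.const_mul 2) ((ha.const_mul γ).add (hb.const_mul γ⁻¹)) fun p => ?_
  exact amgm_pointwise (mul_eq_zero_or_one (ind_eq_zero_or_one _ _) (ind_eq_zero_or_one _ _))
    (ind_eq_zero_or_one _ _) hγ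

/-- Optimising `γ`: if `2y ≤ γa + b/γ` for all `γ > 0` (`a, b ≥ 0`) then `y ≤ √(ab)`. -/
theorem le_sqrt_of_amgm {y a b : ℝ} (ha : 0 ≤ a) (hb : 0 ≤ b)
    (h : ∀ γ : ℝ, 0 < γ → 2 * y ≤ γ * a + γ⁻¹ * b) : y ≤ Real.sqrt (a * b) := by
  by_contra hy
  rw [not_le] at hy
  have hy0 : 0 < y := lt_of_le_of_lt (Real.sqrt_nonneg _) hy
  rcases eq_or_lt_of_le ha with rfl | ha0
  · have h1 := h ((b + 1) / y) (div_pos (by linarith) hy0)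
    rw [mul_zero, zero_add, inv_div] at h1
    have h2 : y / (b + 1) * b < 2 * y := by
      rw [div_mul_eq_mul_div, div_lt_iff₀ (by linarith)]
      nlinarith
    linarith
  rcases eq_or_lt_of_le hb with rfl | hb0
  · have h1 := h (y / a) (div_pos hy0 ha0)
    rw [mul_zero, add_zero, div_mul_cancel₀ _ ha0.ne'] at h1
    linarith
  have hsa := Real.sqrt_pos.2 ha0
  have hsb := Real.sqrt_pos.2 hb0
  have h1 := h (Real.sqrt b / Real.sqrt a) (div_pos hsb hsa)
  have e1 : Real.sqrt b / Real.sqrt a * a = Real.sqrt a * Real.sqrt b := by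
    rw [div_mul_eq_mul_div, div_eq_iff hsa.ne']
    linear_combination (-Real.sqrt b) * Real.mul_self_sqrt ha
  have e2 : (Real.sqrt b / Real.sqrt a)⁻¹ * b = Real.sqrt a * Real.sqrt b := by
    rw [inv_div, div_mul_eq_mul_div, div_eq_iff hsb.ne']
    linear_combination (-Real.sqrt a) * Real.mul_self_sqrt hb
  rw [e1, e2, ← Real.sqrt_mul ha] at h1
  linarith

/-- The integrand `aI` is non-negative. -/
theorem aI_nonneg (j : J) (β : Set ℝ) (p : ℝ × (Fin n → ℝ)) : 0 ≤ D.aI j β p :=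
  mul_nonneg (mul_nonneg (ind_nonneg _ _) (ind_nonneg _ _)) (sq_nonneg _)

/-- `a_{jβ} ≥ 0`. -/
theorem a_nonneg (j : J) (β : Set ℝ) : 0 ≤ D.a j β := integral_nonneg fun p => D.aI_nonneg j β p

/-- `ℓ_{jβ}(t') ≥ 0`. -/
theorem lenE_nonneg (j : J) (β : Set ℝ) (t' : Fin n → ℝ) : 0 ≤ D.lenE j β t' :=
  ENNReal.toReal_nonneg

/-- `B_{jβ}/k ≥ 0`. -/
theorem b_nonneg (j : J) (β : Set ℝ) : 0 ≤ D.b j β :=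
  setIntegral_nonneg D.measurableSet_Ω' fun t' _ => mul_nonneg (sq_nonneg _) (D.lenE_nonneg j β t')

/-- The integrand `yI` is non-negative. -/
theorem yI_nonneg (j : J) (β : Set ℝ) (p : ℝ × (Fin n → ℝ)) : 0 ≤ D.yI j β p :=
  mul_nonneg (mul_nonneg (mul_nonneg (ind_nonneg _ _) (ind_nonneg _ _))
    (mul_nonneg (abs_nonneg _) (ind_nonneg _ _))) (abs_nonneg _)

/-- The binned Cauchy–Schwarz bound `X_{jβ}/k ≤ √(a_{jβ} b_{jβ})` (`γ = √(b/a)`). -/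
theorem y_le_sqrt (j : J) {β : Set ℝ} (hβ : MeasurableSet β) :
    D.y j β ≤ Real.sqrt (D.a j β * D.b j β) :=
  le_sqrt_of_amgm (D.a_nonneg j β) (D.b_nonneg j β) fun γ hγ => by
    rw [← D.b'_eq_b j hβ]
    exact D.two_y_le j hβ hγ

/-! #### The error inner product is controlled by the binned cross terms -/

/-- The product-space integrand `errI` of `∫_{Ω'} E₁ (F₀)₁` is integrable (tame on the box). -/
theorem integrable_errI : Integrable D.errI := by
  have h1 : Integrable fun p : ℝ × (Fin n → ℝ) => D.Fc (Fin.cons p.1 p.2) :=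
    integrable_cons (D.tame_Fc.integrable (volume_simplex_ne_top _ _))
  obtain ⟨C, hC⟩ := bdd_mul (bdd_comp (bdd_ind D.Ω') (fun p : ℝ × (Fin n → ℝ) => p.2))
    (bdd_comp D.tame_margF0.bdd' (fun p : ℝ × (Fin n → ℝ) => p.2))
  exact h1.bdd_mul (c := C) (((measurable_ind D.measurableSet_Ω').comp measurable_snd).mul
    D.measurable_margF0_snd).aestronglyMeasurable
    (ae_of_all _ fun p => by rw [Real.norm_eq_abs]; exact hC p)

/-- `∫_{Ω'} E₁ (F₀)₁ = ∫ 1_{Ω'}(t') (F₀)₁(t') F₀1_{Ω^c}(s, t') d(s, t')` (Fubini). -/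
theorem errInner_eq : D.errInner = ∫ p, D.errI p := by
  unfold errInner
  rw [← integral_indicator D.measurableSet_Ω', integral_prod_eq_integral_integral _ D.integrable_errI]
  congr 1
  funext t'
  have e1 : D.Ω'.indicator (fun t' => marg D.Fc t' * marg D.F0 t') t' =
      (ind D.Ω' t' * marg D.F0 t') * marg D.Fc t' := by
    by_cases ht : t' ∈ D.Ω'
    · rw [indicator_of_mem ht, ind_of_mem ht]
      ring
    · rw [indicator_of_notMem ht, ind_of_notMem ht]
      ring
  rw [e1, show marg D.Fc t' = ∫ s, D.Fc (Fin.cons s t') from rfl, ← integral_const_mul]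
  rfl

/-- Pointwise: the error integrand is dominated by the sum of the binned integrands (cover of `Ω^c`
by the `E_j`, and `t_1 ∈ (τ_{0,j}, S] ⊆ ⋃_i β_{ji}` whenever `t ∈ E_j` and `t' ∈ Ω' ⊆ K·R_n`). -/
theorem abs_errI_le (p : ℝ × (Fin n → ℝ)) : |D.errI p| ≤ ∑ j, ∑ i, D.yI j (D.β j i) p := by
  have hnn : 0 ≤ ∑ j, ∑ i, D.yI j (D.β j i) p :=
    Finset.sum_nonneg fun j _ => Finset.sum_nonneg fun i _ => D.yI_nonneg _ _ _
  by_cases hc : (Fin.cons p.1 p.2 : Fin (n + 1) → ℝ) ∈ scaledSimplex (n + 1) D.S \ D.Ω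
  swap
  · have : D.errI p = 0 := by
      unfold errI Fc
      rw [indicator_of_notMem hc, mul_zero]
    rw [this, abs_zero]
    exact hnn
  by_cases hΩ' : p.2 ∈ D.Ω'
  swap
  · have : D.errI p = 0 := by
      unfold errI
      rw [ind_of_notMem hΩ', zero_mul, zero_mul]
    rw [this, abs_zero]
    exact hnn
  obtain ⟨j, hj⟩ := mem_iUnion.1 (D.cover hc)
  have hsum2 : ∑ i, p.2 i ≤ D.K := (D.Ω'_subset hΩ').2
  have hlt := D.lt_sum_of_mem_E j _ hj
  rw [sum_cons] at hlt
  have hp1 : D.S - D.e j - D.K < p.1 := by linarith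
  have hp1' : p.1 ≤ D.S := (mem_Icc_of_cons_mem_scaledSimplex' (D.E_subset j hj)).2
  obtain ⟨i, hi⟩ := D.β_cover j p.1 hp1 hp1'
  have hval : D.yI j (D.β j i) p = |D.errI p| := by
    unfold yI errI Fc
    rw [ind_of_mem hj, ind_of_mem hi, ind_of_mem hΩ', indicator_of_mem hc, abs_mul, abs_mul,
      abs_one]
    ring
  calc |D.errI p| = D.yI j (D.β j i) p := hval.symm
    _ ≤ ∑ i', D.yI j (D.β j i') p :=
        Finset.single_le_sum (fun i' _ => D.yI_nonneg _ _ _) (Finset.mem_univ i)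
    _ ≤ ∑ j', ∑ i', D.yI j' (D.β j' i') p :=
        Finset.single_le_sum (f := fun j' => ∑ i', D.yI j' (D.β j' i') p)
          (fun j' _ => Finset.sum_nonneg fun i' _ => D.yI_nonneg _ _ _) (Finset.mem_univ j)

/-- `∫_{Ω'} E₁ (F₀)₁ ≤ Σ_j Σ_i y_{j,β_{ji}}` (the cover step `abs_errI_le` integrated). -/
theorem errInner_le : D.errInner ≤ ∑ j, ∑ i, D.y j (D.β j i) := by
  rw [D.errInner_eq]
  have hint : ∀ j, Integrable fun p => ∑ i, D.yI j (D.β j i) p := fun j =>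
    integrable_finsetSum _ fun i _ => (D.tame_yI j (D.measurableSet_β j i)).integrable D.volume_box_ne_top
  calc ∫ p, D.errI p ≤ ∫ p, |D.errI p| := le_trans (le_abs_self _) abs_integral_le_integral_abs
    _ ≤ ∫ p, ∑ j, ∑ i, D.yI j (D.β j i) p :=
        integral_mono D.integrable_errI.abs (integrable_finsetSum _ fun j _ => hint j)
          fun p => D.abs_errI_le p
    _ = ∑ j, ∑ i, D.y j (D.β j i) := by
        rw [integral_finsetSum _ fun j _ => hint j]
        refine Finset.sum_congr rfl fun j _ => ?_
        rw [integral_finsetSum _ fun i _ =>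
          (D.tame_yI j (D.measurableSet_β j i)).integrable D.volume_box_ne_top]
        rfl

/-- `√(A_{jβ} B_{jβ}) = k · √(a_{jβ} · B_{jβ}/k)` (`A = k a`, `B = k b`). -/
theorem sqrt_A_mul_B (j : J) {β : Set ℝ} (hβ : MeasurableSet β) :
    Real.sqrt (D.A j β * D.B j β) = ((n : ℝ) + 1) * Real.sqrt (D.a j β * D.b j β) := by
  rw [D.A_eq j hβ]
  unfold B
  have hk : (0 : ℝ) ≤ (n : ℝ) + 1 := by positivity
  rw [show ((n : ℝ) + 1) * D.a j β * (((n : ℝ) + 1) * D.b j β) =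
      (((n : ℝ) + 1) * ((n : ℝ) + 1)) * (D.a j β * D.b j β) by ring,
    Real.sqrt_mul (mul_nonneg hk hk), Real.sqrt_mul_self hk]

/-- `k ∫_{Ω'} E₁ (F₀)₁ ≤ Σ_j Σ_i √(A_{ji} B_{ji})`. -/
theorem errInner_le_cross : ((n : ℝ) + 1) * D.errInner ≤ D.cross := by
  have hk : (0 : ℝ) ≤ (n : ℝ) + 1 := by positivity
  calc ((n : ℝ) + 1) * D.errInner ≤ ((n : ℝ) + 1) * ∑ j, ∑ i, D.y j (D.β j i) :=
        mul_le_mul_of_nonneg_left D.errInner_le hk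
    _ = ∑ j, ∑ i, ((n : ℝ) + 1) * D.y j (D.β j i) := by
        rw [Finset.mul_sum]
        exact Finset.sum_congr rfl fun j _ => Finset.mul_sum _ _ _
    _ ≤ ∑ j, ∑ i, ((n : ℝ) + 1) * Real.sqrt (D.a j (D.β j i) * D.b j (D.β j i)) :=
        Finset.sum_le_sum fun j _ => Finset.sum_le_sum fun i _ =>
          mul_le_mul_of_nonneg_left (D.y_le_sqrt j (D.measurableSet_β j i)) hk
    _ = D.cross := by
        unfold cross
        exact Finset.sum_congr rfl fun j _ => Finset.sum_congr rfl fun i _ =>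
          (D.sqrt_A_mul_B j (D.measurableSet_β j i)).symm

/-- **Lemma 6.2** (`lem:cert`, eq. (6.2)), for the data `D`: with `F = F₀1_Ω` and
`G_m = (F₀)_m 1_{Ω'}`,
`Σ_m (2⟨F_m, G_m⟩ − ⟨G_m, G_m⟩) ≥ k J^K(F₀) − k L_G − 2 Σ_j Σ_i √(A_{ji} B_{ji})`. -/
theorem certIneq :
    ((n : ℝ) + 1) * D.JK - ((n : ℝ) + 1) * D.LG - 2 * D.cross ≤ varLHS D.F (fun _ => D.G) := by
  rw [D.varLHS_eq]
  linarith [D.errInner_le_cross]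

end CertSetup

end

end Summit.Parity.GeneralizedHardyLittlewood.Theorems.Dhl42
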